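import Mathlib
import HarnessLib
import Literature.MathematicalPhysics.QuantumLattice.MatsubaraSectorPropagator
import Summits.HubbardSuperconductivity.HubbardSuperconductivity.Theorems.KLProgrammeKLRegimeTwoPointAssemblyFree

/-!
# Route `KLProgramme` — child `KLRegimeVolumeLimitV7` (stmt-HubbardSuperconductivity-19665), order-`U²` rung of the volume-limit slot:
# the FRAME PROPAGATOR SYMBOL FAMILY is admissible for the model-free sunset theorem
# (cell gate-hubbard-kl, seat hubbard-kl-k3c4-p1; companion of `KLProgrammeKLRegimeVolumeLimitSunset.klSunset_volLimit`)

The model-free sunset theorem (`…VolumeLimitSunset.klSunset_volLimit`, seat k3c4-p1) takes a symbol family `g : ℤ → (Fin 2 → ℝ) → ℂ`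
with three properties: each `g a` CONTINUOUS, `2π`-PERIODIC in every coordinate, and BOUNDED by `C/|a + ½|`.  The instance of record
is the frame propagator of the countertermed covariance `C^K` read in continuum momentum,

  `g a x = (e_K(x) - iω_a)⁻¹`,  `e_K = bandCT μ K` (`= nambuXiCT` on the grid, `nambuXiCT_eq_bandCT`),  `ω_a = fermiMatsubara β a = π(2a+1)/β`

(BGM's `ĝ = (-ik₀ + e)⁻¹`; `matsubaraFreq β M i = fermiMatsubara β (matsubaraInt M i)`).  This module proves the three properties for
it, for every `β > 0`, `μ`, frame `K` and label `a`:

* `klfs_frameDenom_im`, `klfs_frameDenom_ne_zero`, `klfs_frameSymbol_continuous` — the denominator has imaginary part `-ω_a ≠ 0`;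
* `klfs_bandCT_periodic`, `klfs_frameSymbol_periodic` — `e_K` is `(2πℤ)²`-periodic (`TrigPolyC4v.eval_periodic`, `cos`);
* `klfs_abs_fermiMatsubara`, `klfs_frameSymbol_norm_le` — `|ω_a| = (2π/β)|a+½|` and **`‖(e_K(x) - iω_a)⁻¹‖ ≤ (β/2π)/|a+½|`**.

Pure bookkeeping; nothing is asserted about the model.  With these, `klSunset_volLimit` applies to the frame symbol with `C = β/2π`
(the corollary is one `exact` once `…VolumeLimitSunset` is in the tree).
-/

noncomputable section

namespace Summit.HubbardSuperconductivity.HubbardSuperconductivity.Theorems.KLRegimeSplit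

set_option linter.dupNamespace false -- summit = problem name (single-conjunct summit), D-0017

open Real Literature.MathematicalPhysics.QuantumLattice Literature.Probability.LatticeModels
open Summit.HubbardSuperconductivity.HubbardSuperconductivity.Theorems.TwoPointAssembly

/-! ## §1 The Matsubara frequency of a label -/

/-- `ω_a = (2π/β)(a + ½)`. -/
theorem klfs_fermiMatsubara_eq (β : ℝ) (a : ℤ) : fermiMatsubara β a = 2 * π / β * ((a : ℝ) + 1 / 2) := by
  unfold fermiMatsubara
  ring

/-- **`|ω_a| = (2π/β)|a + ½|`** (`β > 0`). -/
theorem klfs_abs_fermiMatsubara {β : ℝ} (hβ : 0 < β) (a : ℤ) :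
    |fermiMatsubara β a| = 2 * π / β * |(a : ℝ) + 1 / 2| := by
  rw [klfs_fermiMatsubara_eq, abs_mul, abs_of_pos (by positivity : (0 : ℝ) < 2 * π / β)]

/-- `ω_a ≠ 0` (`β > 0`). -/
theorem klfs_fermiMatsubara_ne_zero {β : ℝ} (hβ : 0 < β) (a : ℤ) : fermiMatsubara β a ≠ 0 := by
  intro h
  have h1 := pi_div_le_abs_fermiMatsubara hβ a
  rw [h, abs_zero] at h1
  exact absurd h1 (not_le.2 (by positivity))

/-! ## §2 The frame symbol `(e_K(x) - iω_a)⁻¹`: denominator, continuity, periodicity, bound -/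

/-- The imaginary part of the denominator is `-ω_a`. -/
theorem klfs_frameDenom_im (β μ : ℝ) (K : TrigPolyC4v) (a : ℤ) (x : Fin 2 → ℝ) :
    ((bandCT μ K x : ℂ) - Complex.I * (fermiMatsubara β a : ℂ)).im = -fermiMatsubara β a := by
  simp [Complex.sub_im, Complex.mul_im, Complex.ofReal_im, Complex.ofReal_re, Complex.I_re, Complex.I_im]

/-- The denominator `e_K(x) - iω_a` never vanishes (`β > 0`). -/
theorem klfs_frameDenom_ne_zero {β : ℝ} (hβ : 0 < β) (μ : ℝ) (K : TrigPolyC4v) (a : ℤ) (x : Fin 2 → ℝ) :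
    (bandCT μ K x : ℂ) - Complex.I * (fermiMatsubara β a : ℂ) ≠ 0 := by
  intro h
  have him := klfs_frameDenom_im β μ K a x
  rw [h, Complex.zero_im] at him
  exact klfs_fermiMatsubara_ne_zero hβ a (by linarith)

/-- **Continuity** of the frame symbol `x ↦ (e_K(x) - iω_a)⁻¹` (`β > 0`). -/
theorem klfs_frameSymbol_continuous {β : ℝ} (hβ : 0 < β) (μ : ℝ) (K : TrigPolyC4v) (a : ℤ) :
    Continuous fun x : Fin 2 → ℝ => ((bandCT μ K x : ℂ) - Complex.I * (fermiMatsubara β a : ℂ))⁻¹ := by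
  have hc : Continuous fun x : Fin 2 → ℝ => (bandCT μ K x : ℂ) - Complex.I * (fermiMatsubara β a : ℂ) :=
    (Complex.continuous_ofReal.comp (continuous_bandCT μ K)).sub continuous_const
  exact hc.inv₀ fun x => klfs_frameDenom_ne_zero hβ μ K a x

/-- The continuum frame band is `(2πℤ)²`-periodic. -/
theorem klfs_bandCT_periodic (μ : ℝ) (K : TrigPolyC4v) (x : Fin 2 → ℝ) (m : Fin 2 → ℤ) :
    bandCT μ K (fun i => x i + 2 * π * (m i : ℝ)) = bandCT μ K x := by
  have harg : (fun i => x i + 2 * π * (m i : ℝ)) = fun i => x i + (m i : ℝ) * (2 * π) := by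
    funext i; ring
  have hcos : ∀ i, Real.cos (x i + (m i : ℝ) * (2 * π)) = Real.cos (x i) := fun i =>
    Real.cos_add_int_mul_two_pi (x i) (m i)
  unfold bandCT
  rw [harg, TrigPolyC4v.eval_periodic K x m]
  simp only [hcos]

/-- **Periodicity** of the frame symbol. -/
theorem klfs_frameSymbol_periodic (β μ : ℝ) (K : TrigPolyC4v) (a : ℤ) (x : Fin 2 → ℝ) (m : Fin 2 → ℤ) :
    ((bandCT μ K (fun i => x i + 2 * π * (m i : ℝ)) : ℂ) - Complex.I * (fermiMatsubara β a : ℂ))⁻¹ =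
      ((bandCT μ K x : ℂ) - Complex.I * (fermiMatsubara β a : ℂ))⁻¹ := by
  rw [klfs_bandCT_periodic]

/-- **The bound** `‖(e_K(x) - iω_a)⁻¹‖ ≤ (β/2π)/|a + ½|` (`β > 0`): the modulus of the denominator is at least `|Im| = |ω_a| =
(2π/β)|a+½|`. -/
theorem klfs_frameSymbol_norm_le {β : ℝ} (hβ : 0 < β) (μ : ℝ) (K : TrigPolyC4v) (a : ℤ) (x : Fin 2 → ℝ) :
    ‖((bandCT μ K x : ℂ) - Complex.I * (fermiMatsubara β a : ℂ))⁻¹‖ ≤ β / (2 * π) / |(a : ℝ) + 1 / 2| := by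
  set z : ℂ := (bandCT μ K x : ℂ) - Complex.I * (fermiMatsubara β a : ℂ) with hz
  have ha : 0 < |(a : ℝ) + 1 / 2| := by
    rw [abs_pos]
    intro h
    have h2 : (2 * a + 1 : ℤ) = 0 := by
      have : (2 : ℝ) * a + 1 = 0 := by linarith
      exact_mod_cast this
    omega
  have hω : 2 * π / β * |(a : ℝ) + 1 / 2| ≤ ‖z‖ := by
    rw [← klfs_abs_fermiMatsubara hβ a, ← abs_neg, ← klfs_frameDenom_im β μ K a x]
    exact Complex.abs_im_le_norm z
  have hpos : 0 < 2 * π / β * |(a : ℝ) + 1 / 2| := by positivity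
  rw [norm_inv]
  calc ‖z‖⁻¹ ≤ (2 * π / β * |(a : ℝ) + 1 / 2|)⁻¹ := inv_anti₀ hpos hω
    _ = β / (2 * π) / |(a : ℝ) + 1 / 2| := by
        field_simp

end Summit.HubbardSuperconductivity.HubbardSuperconductivity.Theorems.KLRegimeSplit

end
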